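import Summits.ABC.IUTFork.Joshi.ThetaLociProducts
import Summits.ABC.IUTFork.Joshi.BundlingRings

/-!
# [J-III] §7.8 on §7.5: the `BundlingDatum` of `ThetaLociProducts.lean` BUILT from E-t13's `PrimeBundlingDatum`
# (merge-debt «J3:§7.5/§7.7 = E-t13» of slot T-15, discharged)

Block E of the abc-iut cell (rung LADDER-ABC:A2.E; seat abc-iut-E-t15). PROOF/CONSTRUCTION-ONLY companion, object ↔ object
(E-PLAN R14-clean: imports two Joshi object files, nothing of our frozen interface). K. Joshi, arXiv:2401.13508v4 = [J-III]
(unrefereed, bib `Joshi2024ATS3`; no side taken on [IUTchIII] Cor. 3.12, on Joshi's claims or on Mochizuki's reports on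
them; typed ≠ proved ≠ endorsed). Render locators «p.N l.M» as in the two imported files.

WHAT THIS FILE DOES. `ThetaLociProducts.lean` (p429035) typed §7.8 over an abstract carrier `BundlingDatum K B A W J` whose
fields are exactly what §7.8 reads from §7.5: the fields `E′_w ⊂ Q̄_p`, the presentation `B̆_p ≅ B_p ⊗_{ℚ_p} (⊕_w E′_w)`
((7.5.2.1)/Lem. 7.5.2.3/(7.8.1.3)) and the locus `Θ̃_{Joshi,p} ⊂ B̆_p^{ℓ*}` ((7.5.3.1)); `BundlingRings.lean` (E-t13, p429549)
typed §7.5/§7.7 as `PrimeBundlingDatum lstar Qp Bp I E BE T` and wrote down the intended instantiation in its module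
docstring («`K := Qp`, `B := Bp`, `A := BundleTensE` (his `B̑_p`), `W := ↥Vss`, `J := Fin lstar`, `thetaLocus :=` the image
of `locusBundled`»; «`bundleTensEEquiv` … its inverse is the presentation field `BundlingDatum.bundlingIso` … modulo E-t15's
choice `E′_w ⊂ Q̄_p`»). Here that instantiation is CONSTRUCTED (`PrimeBundlingDatum.toBundlingDatum`), so that the §7.8 loci
`Θ̂_{Joshi,p}`, `Θ̂̂_{Joshi,p}` and the typed claim of Lemma 7.8.1.2 are literally statements about E-t13's typed rings:
* the abstract p-adic fields `E w` of `PrimeBundlingDatum` are realised «contained in `Q̄_p`» (p.68 l.10–12) through a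
  CHOSEN `ℚ_p`-embedding into Mathlib's `AlgebraicClosure Qp` (`IsAlgClosed.lift`; requires — and this is the one
  hypothesis added — each `E′_w / ℚ_p` FINITE, i.e. `[∀ w, FiniteDimensional Qp (E w)]`, which is print's «finite extensions»
  p.68 l.10); the choice is immaterial up to `ℚ_p`-isomorphism (`embEquiv`);
* `bundlingIso : B̑_p ≃ₐ[B_p] B_p ⊗_{ℚ_p} (⊕_w E′_w)` = E-t13's `bundleTensEEquiv.symm` followed by the chosen identifications;
* `thetaLocus` = the image of E-t13's `locusBundled` ((7.5.3.1)) under the coordinatewise comparison map (7.5.2.2)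
  `bundleOddToTensE` («The theta-values locus obviously embeds in `B̑_p^{ℓ*}` by means of the diagonal embedding», p.59 l.42–43).
DERIVED: the §7.8.2 loci of the instantiated datum unfold to images of E-t13's locus (`hatHatLocus_toBundlingDatum`,
`hatLocus_toBundlingDatum`). Nothing is asserted; no instance, no notation. Norms (Rmk. 7.8.3.2) are NOT instantiated here:
E-t13's `normT` lives on the §7.7 ring `B̆⊗_{L′,p} = ⊗_{ℚ_p} B_{E′_w}`, not on `B̑_p` or its `B_p`-tensor power (print gives no
formula for the §7.8 norms, p.69 l.60–62) — that merge-debt stays open and is E-t14/E-t13's call.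
-/

noncomputable section

open scoped TensorProduct

namespace Summit.ABC.IUTFork.Joshi.ATS3

namespace PrimeBundlingDatum

variable {lstar : ℕ} {Qp Bp : Type} [Field Qp] [CommRing Bp] [Algebra Qp Bp] {I : Type} [Fintype I] [DecidableEq I]
  {E BE : I → Type} [∀ w, Field (E w)] [∀ w, Algebra Qp (E w)] [∀ w, CommRing (BE w)] [∀ w, Algebra Qp (BE w)]
  [∀ w, Algebra Bp (BE w)] {T : Type} [CommRing T] (D : PrimeBundlingDatum lstar Qp Bp I E BE T)

/-- **`Θ̃_{Joshi,p} ⊂ B̑_p^{ℓ*}`** as §7.8 reads it ((7.8.2.2), p.68 l.42): the image of E-t13's bundled locus (7.5.3.1)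
`locusBundled ⊂ (⊕_w B_{E′_w})^{ℓ*}` under the coordinatewise comparison map (7.5.2.2) `bundleOddToTensE` («The theta-values
locus obviously embeds in `B̑_p^{ℓ*}` by means of the diagonal embedding», p.59 l.42–43). [claim: Joshi2024ATS3, status: disputed] -/
def thetaLocusTensE : Set (Fin lstar → D.BundleTensE) :=
  (fun z j => D.bundleOddToTensE (z j)) '' D.locusBundled

/-- With the [FF18] input of (7.5.2.2) (`ToTensEInjective`: each `B_{E′_w} ↪ B_p ⊗_{ℚ_p} E′_w`), the passage from E-t13's
bundled locus to the §7.8 locus `Θ̃_{Joshi,p} ⊂ B̑_p^{ℓ*}` loses nothing: the coordinatewise comparison is injective on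
`ℓ*`-tuples. PROVED. -/
theorem thetaLocusTensE_injective (h : D.ToTensEInjective) :
    Function.Injective (fun (z : Fin lstar → D.BundleOdd) j => D.bundleOddToTensE (z j)) :=
  fun _ _ hzz => funext fun j => D.bundleOddToTensE_injective h (congrFun hzz j)

/-! PRINT: «finite extensions `E″_α` of `ℚ_p`» (p.68 l.10) — from here on each `E′_w / ℚ_p` is finite-dimensional. -/
variable [∀ w, FiniteDimensional Qp (E w)]

/-- A CHOSEN `ℚ_p`-embedding `E′_w ↪ Q̄_p` of the finite extension `E′_w / ℚ_p` into Mathlib's algebraic closure of `ℚ_p`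
(`IsAlgClosed.lift`), realising print's «finite extensions `E″_α` of `ℚ_p` contained in `Q̄_p`» (p.68 l.10–12) for the
abstract fields of E-t13's signature. A choice (any two differ by a `ℚ_p`-automorphism of the image); nothing downstream
depends on it beyond `ℚ_p`-isomorphism. [claim: Joshi2024ATS3, status: disputed] -/
def emb (_D : PrimeBundlingDatum lstar Qp Bp I E BE T) (w : I) : E w →ₐ[Qp] AlgebraicClosure Qp :=
  IsAlgClosed.lift

/-- `E′_w` as an intermediate field of `Q̄_p / ℚ_p`: the range of the chosen embedding. [claim: Joshi2024ATS3, status: disputed] -/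
def Esub (w : I) : IntermediateField Qp (AlgebraicClosure Qp) :=
  (D.emb w).fieldRange

/-- The identification `E′_w ≃ₐ[ℚ_p] (its image in Q̄_p)` (an embedding of fields is injective). -/
def embEquiv (w : I) : E w ≃ₐ[Qp] D.Esub w :=
  (IntermediateField.topEquiv (F := Qp) (E := E w)).symm.trans
    ((IntermediateField.equivMap ⊤ (D.emb w)).trans
      (IntermediateField.equivOfEq (AlgHom.fieldRange_eq_map (D.emb w)).symm))

/-- The image of `E′_w` in `Q̄_p` is finite over `ℚ_p` (transport of `FiniteDimensional` along `embEquiv`). PROVED. -/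
theorem finiteDimensional_Esub (w : I) : FiniteDimensional Qp (D.Esub w) :=
  LinearEquiv.finiteDimensional (D.embEquiv w).toLinearEquiv

/-- The identification `⊕_{w ∈ V^{odd,ss}_p} E′_w ≃ₐ[ℚ_p] ⊕_w (image of E′_w in Q̄_p)`, componentwise `embEquiv`. -/
def piEmbEquiv : ((w : D.Vss) → E w.1) ≃ₐ[Qp] ((w : D.Vss) → D.Esub w.1) :=
  AlgEquiv.piCongrRight fun w => D.embEquiv w.1

/-- **The presentation (7.8.1.3) of `B̑_p` built from E-t13's Lemma 7.5.2.3**: `B̑_p = ⊕_w (B_p ⊗_{ℚ_p} E′_w) ≃ₐ[B_p]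
B_p ⊗_{ℚ_p} (⊕_w E′_w)` (`bundleTensEEquiv.symm`, p.59 l.44–57) followed by the chosen identification of the `E′_w` with
subfields of `Q̄_p`. CONSTRUCTED. [claim: Joshi2024ATS3, status: disputed] -/
def presentationIso : D.BundleTensE ≃ₐ[Bp] (Bp ⊗[Qp] ((w : D.Vss) → D.Esub w.1)) :=
  D.bundleTensEEquiv.symm.trans (Algebra.TensorProduct.congr AlgEquiv.refl D.piEmbEquiv)

/-- **The §7.8 carrier BUILT from the §7.5 carrier** — E-t13's prescribed instantiation of E-t15's `BundlingDatum`
(BundlingRings.lean module docstring): `K := ℚ_p`, `B := B_p`, `A := B̑_p = ⊕_{w∈V^{odd,ss}_p} B_p ⊗_{ℚ_p} E′_w` (`BundleTensE`),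
`W := V^{odd,ss}_p` (`↥D.Vss`), `J := {1,…,ℓ*}` (`Fin lstar`); `Eprime w` = the image of `E′_w` in `Q̄_p`, `bundlingIso =
presentationIso`, `thetaLocus = thetaLocusTensE`. CONSTRUCTED (merge-debt «J3:§7.5/§7.7 = E-t13» of ThetaLociProducts.lean
discharged at the level of rings and loci). [claim: Joshi2024ATS3, status: disputed] -/
def toBundlingDatum : BundlingDatum Qp Bp D.BundleTensE D.Vss (Fin lstar) where
  finite_W := inferInstance
  Eprime w := D.Esub w.1
  finiteDimensional_Eprime w := D.finiteDimensional_Esub w.1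
  bundlingIso := D.presentationIso
  thetaLocus := D.thetaLocusTensE

/-- The theta-values locus of the instantiated §7.8 carrier is the (7.5.2.2)-image of E-t13's bundled locus (by
construction). PROVED. -/
theorem toBundlingDatum_thetaLocus : D.toBundlingDatum.thetaLocus = D.thetaLocusTensE := rfl

/-- **`Θ̂̂_{Joshi,p} ⊂ B̑_p` on E-t13's rings** ((7.8.2.3)–(7.8.2.4)): the multiplicative locus of the instantiated carrier is
the set of products `∏_j ι(z_j)` over the bundled tuples `z ∈ Θ̃^{B̆}_{Joshi,p}` of (7.5.3.1), `ι` = (7.5.2.2). PROVED. -/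
theorem hatHatLocus_toBundlingDatum :
    D.toBundlingDatum.hatHatLocus = (fun z => ∏ j, D.bundleOddToTensE (z j)) '' D.locusBundled := by
  rw [BundlingDatum.hatHatLocus, toBundlingDatum_thetaLocus, thetaLocusTensE, Set.image_image]
  rfl

/-- **`Θ̂_{Joshi,p}` on E-t13's rings** ((7.8.2.1)–(7.8.2.2)): the tensor locus of the instantiated carrier is the set of pure
tensors `⊗_j ι(z_j) ∈ B̑_p ⊗_{B_p} ⋯ ⊗_{B_p} B̑_p` over the bundled tuples `z` of (7.5.3.1). PROVED. -/
theorem hatLocus_toBundlingDatum :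
    D.toBundlingDatum.hatLocus = (fun z => toTensor Bp fun j => D.bundleOddToTensE (z j)) '' D.locusBundled := by
  rw [BundlingDatum.hatLocus, toBundlingDatum_thetaLocus, thetaLocusTensE, Set.image_image]

end PrimeBundlingDatum

end Summit.ABC.IUTFork.Joshi.ATS3

end
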